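import Mathlib.Analysis.SpecialFunctions.Log.Basic
import Mathlib.Analysis.SpecialFunctions.Pow.Real
import Mathlib.Analysis.SpecialFunctions.Sqrt
import HarnessLib

/-!
# Pure-ℝ bookkeeping of the log-shell in-window bootstrap (crux `LambertianEuler`, stmt-AtomisticToContinuum-11854, line `Sketch`, sub-goal `bootstrap_consts`)

Elementary real-arithmetic facts behind the in-window bootstrap of Yau's entropy clock for the
Lambertian gas in the log-shell.  With `C ≤ (κ/2) |log ε|` the constant produced by the two
research hearts (at tolerance `ε₁ := ε ^ 4`), `C₀ ≥ 0` the a priori entropy constant,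
`D := 2 C² C₀ + 2 C C₀ + C + 1` and window length `w := min 1 (ε / D)`, we show

* `C² C₀ w ≤ ε / 2` and `C C₀ w ≤ ε / 2` (because `2 C² C₀ ≤ D` and `2 C C₀ ≤ D`);
* `2 ε⁴ (C w + 1) ≤ w ε / 2`, which reduces to `8 ε³ ≤ w`, i.e. to `8 ε² D ≤ 1`; the latter
  follows from `ε |log ε| ≤ 2 √ε` (so `(ε C)² ≤ κ² ε`) and `ε |log ε| ≤ 1` (so `ε C ≤ κ`)
  together with the smallness hypothesis `8 ε (2 C₀ κ² + 2 C₀ κ + κ + 1) ≤ 1`.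

Only Mathlib is used (`Real.abs_log_mul_self_lt`, `Real.log_sqrt`).
-/

noncomputable section

namespace Summit.AtomisticToContinuum.HydrodynamicLimit.Theorems.LambertianContactSwapLambertianEulerBootstrapConsts

/-- For `0 < ε ≤ 1` one has `ε (log ε)² < 4`: apply `|log y · y| < 1` at `y = √ε`. [folklore] -/
private theorem eps_mul_log_sq_lt {ε : ℝ} (hε : 0 < ε) (hε1 : ε ≤ 1) :
    ε * Real.log ε ^ 2 < 4 := by
  have hs0 : 0 < Real.sqrt ε := Real.sqrt_pos.2 hε
  have hs1 : Real.sqrt ε ≤ 1 := by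
    have := Real.sqrt_le_sqrt hε1; rwa [Real.sqrt_one] at this
  have h := Real.abs_log_mul_self_lt (Real.sqrt ε) hs0 hs1
  rw [Real.log_sqrt hε.le] at h
  have hsq : Real.sqrt ε ^ 2 = ε := Real.sq_sqrt hε.le
  have h2 : (Real.log ε / 2 * Real.sqrt ε) ^ 2 < 1 := (sq_lt_one_iff_abs_lt_one _).2 h
  calc ε * Real.log ε ^ 2 = 4 * (Real.log ε / 2 * Real.sqrt ε) ^ 2 := by
        rw [mul_pow, hsq]; ring
    _ < 4 := by linarith

/-- From `0 ≤ C ≤ (κ/2) |log ε|` with `0 < ε ≤ 1`: `(ε C)² ≤ κ² ε` and `ε C ≤ κ`. [folklore] -/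
private theorem epsC_bounds {C κ ε : ℝ} (hC : 0 ≤ C) (hκ : 0 < κ) (hε : 0 < ε) (hε1 : ε ≤ 1)
    (hCle : C ≤ κ / 2 * |Real.log ε|) :
    (ε * C) ^ 2 ≤ κ ^ 2 * ε ∧ ε * C ≤ κ := by
  have h1 : ε * |Real.log ε| < 1 := by
    have := Real.abs_log_mul_self_lt ε hε hε1
    rwa [abs_mul, abs_of_pos hε, mul_comm] at this
  have h2 : ε * Real.log ε ^ 2 < 4 := eps_mul_log_sq_lt hε hε1
  have hX : ε * C ≤ κ / 2 * (ε * |Real.log ε|) := by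
    calc ε * C ≤ ε * (κ / 2 * |Real.log ε|) := mul_le_mul_of_nonneg_left hCle hε.le
      _ = κ / 2 * (ε * |Real.log ε|) := by ring
  have hX0 : 0 ≤ ε * C := mul_nonneg hε.le hC
  refine ⟨?_, ?_⟩
  · calc (ε * C) ^ 2 ≤ (κ / 2 * (ε * |Real.log ε|)) ^ 2 := pow_le_pow_left₀ hX0 hX 2
      _ = κ ^ 2 / 4 * ε * (ε * Real.log ε ^ 2) := by
          rw [mul_pow, mul_pow, sq_abs]; ring
      _ ≤ κ ^ 2 / 4 * ε * 4 := mul_le_mul_of_nonneg_left h2.le (by positivity)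
      _ = κ ^ 2 * ε := by ring
  · calc ε * C ≤ κ / 2 * (ε * |Real.log ε|) := hX
      _ ≤ κ / 2 * 1 := mul_le_mul_of_nonneg_left h1.le (by positivity)
      _ ≤ κ := by linarith

/-- The key smallness estimate `8 ε² D ≤ 1` for `D = 2 C² C₀ + 2 C C₀ + C + 1`, obtained from
`(ε C)² ≤ κ² ε`, `ε C ≤ κ`, `ε² ≤ ε` and `8 ε (2 C₀ κ² + 2 C₀ κ + κ + 1) ≤ 1`. [folklore] -/
private theorem key_estimate {C C₀ κ ε : ℝ} (hC₀ : 0 ≤ C₀) (hε : 0 < ε)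
    (hε1 : ε ≤ 1) (hX2 : (ε * C) ^ 2 ≤ κ ^ 2 * ε) (hX1 : ε * C ≤ κ)
    (hsmall : ε * (8 * (2 * C₀ * κ ^ 2 + 2 * C₀ * κ + κ + 1)) ≤ 1) :
    8 * ε ^ 2 * (2 * C ^ 2 * C₀ + 2 * C * C₀ + C + 1) ≤ 1 := by
  have e1 : 2 * (ε * C) ^ 2 * C₀ ≤ 2 * (κ ^ 2 * ε) * C₀ :=
    mul_le_mul_of_nonneg_right (mul_le_mul_of_nonneg_left hX2 (by norm_num)) hC₀
  have e2 : 2 * ε * (ε * C) * C₀ ≤ 2 * ε * κ * C₀ :=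
    mul_le_mul_of_nonneg_right (mul_le_mul_of_nonneg_left hX1 (by positivity)) hC₀
  have e3 : ε * (ε * C) ≤ ε * κ := mul_le_mul_of_nonneg_left hX1 hε.le
  have e4 : ε ^ 2 ≤ ε := by nlinarith
  calc 8 * ε ^ 2 * (2 * C ^ 2 * C₀ + 2 * C * C₀ + C + 1)
        = 8 * (2 * (ε * C) ^ 2 * C₀ + 2 * ε * (ε * C) * C₀ + ε * (ε * C) + ε ^ 2) := by ring
    _ ≤ 8 * (2 * (κ ^ 2 * ε) * C₀ + 2 * ε * κ * C₀ + ε * κ + ε) := by linarith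
    _ = ε * (8 * (2 * C₀ * κ ^ 2 + 2 * C₀ * κ + κ + 1)) := by ring
    _ ≤ 1 := hsmall

/-- If `0 ≤ a`, `2 a ≤ D`, `0 < D` and `0 < ε`, then `a · min 1 (ε / D) ≤ ε / 2`. [folklore] -/
private theorem mul_min_le_half {a D ε : ℝ} (ha : 0 ≤ a) (haD : 2 * a ≤ D) (hD : 0 < D)
    (hε : 0 < ε) : a * min 1 (ε / D) ≤ ε / 2 := by
  calc a * min 1 (ε / D) ≤ a * (ε / D) := mul_le_mul_of_nonneg_left (min_le_right _ _) ha
    _ = a / D * ε := by ring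
    _ ≤ 1 / 2 * ε := by
        apply mul_le_mul_of_nonneg_right _ hε.le
        rw [div_le_iff₀ hD]; linarith
    _ = ε / 2 := by ring

/-- The third bootstrap inequality in abstract form: if `0 ≤ C ≤ D`, `0 < D`, `0 < ε ≤ 1/2`,
`w ≤ ε / D` and `8 ε³ ≤ w`, then `2 ε⁴ (C w + 1) ≤ w ε / 2`. [folklore] -/
private theorem third_bound {C D ε w : ℝ} (hC : 0 ≤ C) (hε : 0 < ε) (hε2 : ε ≤ 1 / 2)
    (hD : 0 < D) (hCD : C ≤ D) (hw1 : w ≤ ε / D) (hkey : 8 * ε ^ 3 ≤ w) :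
    2 * ε ^ 4 * (C * w + 1) ≤ w * ε / 2 := by
  have hCw : C * w ≤ 1 := by
    calc C * w ≤ C * (ε / D) := mul_le_mul_of_nonneg_left hw1 hC
      _ = C / D * ε := by ring
      _ ≤ 1 * ε := by
          apply mul_le_mul_of_nonneg_right _ hε.le
          rw [div_le_iff₀ hD, one_mul]; exact hCD
      _ ≤ 1 := by linarith
  calc 2 * ε ^ 4 * (C * w + 1) ≤ 2 * ε ^ 4 * 2 := by
        apply mul_le_mul_of_nonneg_left _ (by positivity); linarith
    _ = 8 * ε ^ 3 * ε / 2 := by ring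
    _ ≤ w * ε / 2 := by gcongr

/-- **Bootstrap constants of the log-shell entropy clock.**  Let `0 ≤ C`, `0 ≤ C₀`, `0 < κ`,
`0 < ε ≤ 1/2` with `C ≤ (κ/2) |log ε|` and `8 ε (2 C₀ κ² + 2 C₀ κ + κ + 1) ≤ 1`, and put
`D := 2 C² C₀ + 2 C C₀ + C + 1`, `w := min 1 (ε / D)` (the bootstrap window).  Then
`C² C₀ w ≤ ε/2`, `C C₀ w ≤ ε/2`, and `2 ε⁴ (C w + 1) ≤ w ε / 2`.  The first two use
`2 C² C₀ ≤ D`, `2 C C₀ ≤ D`; the third reduces to `8 ε³ ≤ w`, i.e. `8 ε³ ≤ 1` (from `ε ≤ 1/2`)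
and `8 ε² D ≤ 1`, which follows from `ε |log ε| ≤ 2√ε` and `ε |log ε| ≤ 1`
(`Real.abs_log_mul_self_lt`) giving `(ε C)² ≤ κ² ε`, `ε C ≤ κ`. [folklore] -/
theorem bootstrap_consts : ∀ {C C₀ κ ε : ℝ}, 0 ≤ C → 0 ≤ C₀ → 0 < κ → 0 < ε → ε ≤ 1 / 2 → C ≤ κ / 2 * |Real.log ε| → ε * (8 * (2 * C₀ * κ ^ 2 + 2 * C₀ * κ + κ + 1)) ≤ 1 → C ^ 2 * C₀ * min 1 (ε / (2 * C ^ 2 * C₀ + 2 * C * C₀ + C + 1)) ≤ ε / 2 ∧ C * C₀ * min 1 (ε / (2 * C ^ 2 * C₀ + 2 * C * C₀ + C + 1)) ≤ ε / 2 ∧ 2 * ε ^ 4 * (C * min 1 (ε / (2 * C ^ 2 * C₀ + 2 * C * C₀ + C + 1)) + 1) ≤ min 1 (ε / (2 * C ^ 2 * C₀ + 2 * C * C₀ + C + 1)) * ε / 2 := by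
  intro C C₀ κ ε hC hC₀ hκ hε hε2 hCle hsmall
  have hε1 : ε ≤ 1 := by linarith
  have hCC₀ : 0 ≤ C * C₀ := mul_nonneg hC hC₀
  have hC2C₀ : 0 ≤ C ^ 2 * C₀ := mul_nonneg (sq_nonneg C) hC₀
  have hD0 : 0 < 2 * C ^ 2 * C₀ + 2 * C * C₀ + C + 1 := by nlinarith
  have hCD : C ≤ 2 * C ^ 2 * C₀ + 2 * C * C₀ + C + 1 := by nlinarith
  obtain ⟨hX2, hX1⟩ := epsC_bounds hC hκ hε hε1 hCle
  refine ⟨?_, ?_, ?_⟩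
  · exact mul_min_le_half hC2C₀ (by nlinarith) hD0 hε
  · exact mul_min_le_half hCC₀ (by nlinarith) hD0 hε
  · have hK : 8 * ε ^ 2 * (2 * C ^ 2 * C₀ + 2 * C * C₀ + C + 1) ≤ 1 :=
      key_estimate hC₀ hε hε1 hX2 hX1 hsmall
    have h81 : 8 * ε ^ 3 ≤ 1 := by
      have h3 : ε ^ 3 ≤ (1 / 2) ^ 3 := pow_le_pow_left₀ hε.le hε2 3
      norm_num at h3
      linarith
    have h8D : 8 * ε ^ 3 ≤ ε / (2 * C ^ 2 * C₀ + 2 * C * C₀ + C + 1) := by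
      rw [le_div_iff₀ hD0]
      calc 8 * ε ^ 3 * (2 * C ^ 2 * C₀ + 2 * C * C₀ + C + 1)
            = ε * (8 * ε ^ 2 * (2 * C ^ 2 * C₀ + 2 * C * C₀ + C + 1)) := by ring
        _ ≤ ε * 1 := mul_le_mul_of_nonneg_left hK hε.le
        _ = ε := mul_one ε
    exact third_bound hC hε hε2 hD0 hCD (min_le_right _ _) (le_min h81 h8D)

end Summit.AtomisticToContinuum.HydrodynamicLimit.Theorems.LambertianContactSwapLambertianEulerBootstrapConsts

end
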